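import Mathlib
import Summits.NavierStokesRegularity.NavierStokesRegularity.Theorems.FilamentSkeletonRssDefectColumnGateAzimuthalBlockTwoZone

/-!
# Route `FilamentSkeletonRss` · crux `TransverseReduction1AG` (stmt-NavierStokesRegularity-27853; A1L twin stmt-23297) · line
# `defect_column_gate_1AG/1AL` — the LOOP CONDITION of the two-zone theorem `twoZone_sup_le`: reduction to an explicit smallness inequality

Helper file (`--supports stmt-NavierStokesRegularity-27853 --as helper`; seat ns-filament-s2aloc-p1 g2; note ARCHITECTURE-B2B3-s2aloc-g2.md v5 §8).

`twoZone_sup_le` (p680567) is conditional on the LOOP inequality `e₁(α₁(β₁φ₁ + β₂ξ₁) + α₂(τ₁φ₁ + τ₂ξ₁)) ≤ 1/2` among its abbreviations and on a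
free extraction parameter `θ′ > 0`.  `twoZone_loop_reduction`: with the CHOICE `θ′ := (u₀ − 1/γ)/(e·(A₂b + 1)·c_Φ)` the third term is exactly `1/4`,
and the loop inequality follows from the single explicit condition
`240π·a₁·c_φ/m·(1+u₀)³/Rc + 15a₁γ²/(2m²)·(1+u₀)⁴/E + Rc(1+u₀)/(55296πm·E) ≤ 1/4`, `E = e^{γu₀/4}`,
with `a₂ = (20/m)(4π(γ+1) + 4) + 1`, `c_φ = 12(2(1+36γ²) + 81γ/32 + 81/64)`, `a₁ = γ + 12a₂c_φ` (polynomial in `γ, 1/m`).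
`twoZone_loop_large`: with `u₀ := (8/γ)log Rc` (`E = Rc²`, i.e. `A = 2`) there is an explicit `R₀(γ, m) ≥ 1` such that for `Rc ≥ R₀` the inner
radius satisfies `64/γ ≤ u₀`, `1 ≤ u₀`, `e^{γu₀/4} = Rc²` and the smallness condition (via `log x ≤ 8·x^{1/8}`: the condition is `O(log⁴Rc/√Rc·…)`).
So for `Rc ≥ R₀(γ,m)` (and `40π|ρ|(u₀+6/γ) ≤ Rc`, `U ≥ u₀+3/γ`) `twoZone_sup_le` applies UNCONDITIONALLY with `θ′` as above: the two-zone bound with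
loss `Rc^{O(1)}·poly(log Rc)` — what is left to the caller is only the `N² ≤ sup(1+u)⁴(a²+b²)` absorption (coefficient `∝ Rc^{2−2A}(1+u₀)⁴ = Rc^{−2}poly(log Rc)`).
HONEST FRAMING: elementary real inequalities serving an a-priori bound for ONE family of blocks of ONE linear MODEL operator of a hypothetical
blow-up route (MODEL rung, negative side); `WaistColumnGateLoc1A`, `TransverseReduction1AG/1AL` are neither proved nor refuted; nothing here
bears on NS regularity.
-/

set_option linter.dupNamespace false

noncomputable section

namespace Summit.NavierStokesRegularity.NavierStokesRegularity.Theorems.DefectColumnGate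

open Set

set_option maxHeartbeats 1000000 in
/-- **Loop reduction.**  Under the abbreviations of `twoZone_sup_le` and the choice `θ′ = (u₀ − 1/γ)/(e(A₂b+1)c_Φ)`: `θ′ > 0`, and the explicit
smallness condition `hsmall` implies the loop inequality `e₁(α₁(β₁φ₁ + β₂ξ₁) + α₂(τ₁φ₁ + τ₂ξ₁)) ≤ 1/2`. -/
theorem twoZone_loop_reduction {γ m Rc u₀ θ' Kb c₁ κ A₂b cΦ φ₁ ξ₁ β₁ β₂ τ₁ τ₂ e₁ α₁ α₂ a₂ cφ a₁ : ℝ}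
    (hγ : 0 < γ) (hm : 2 ≤ m) (hRc : 1 ≤ Rc) (hu₀ : 64 / γ ≤ u₀) (hu₀1 : 1 ≤ u₀)
    (hKb : Kb = 2 * Real.pi * (u₀ + 2 / γ + 4 / γ)) (hc₁ : c₁ = (1 - 16 / (5 * m ^ 2)) * m) (hκ : κ = γ ^ 2 * Rc / (16 * Real.pi * m))
    (hA₂b : A₂b = 4 * ((γ + 1) * Kb + 4) / c₁)
    (hcΦ : cΦ = 12 * ((1 + 36 * γ ^ 2) * (u₀ + 3 / γ) + 81 * γ / 32 + 81 / 64))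
    (hφ₁ : φ₁ = Real.exp (γ * (u₀ + 3 / γ) / 4) * cΦ) (hξ₁ : ξ₁ = u₀ ^ 2 / 2)
    (hβ₁ : β₁ = Kb * (4 / (c₁ * Rc))) (hβ₂ : β₂ = Kb * (4 * κ / (c₁ * Rc)))
    (hτ₁ : τ₁ = A₂b + 1) (hτ₂ : τ₂ = κ * (1 + A₂b))
    (he₁ : e₁ = Real.exp (1 / 4) / Real.exp (γ * u₀ / 4)) (hα₁ : α₁ = γ + 1 / θ') (hα₂ : α₂ = θ' / (4 * (u₀ - 1 / γ)))
    (hθ' : θ' = (u₀ - 1 / γ) / (Real.exp 1 * (A₂b + 1) * cΦ))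
    (ha₂ : a₂ = 20 / m * (4 * Real.pi * (γ + 1) + 4) + 1)
    (hcφ : cφ = 12 * (2 * (1 + 36 * γ ^ 2) + 81 * γ / 32 + 81 / 64))
    (ha₁ : a₁ = γ + 12 * a₂ * cφ)
    (hsmall : 240 * Real.pi * a₁ * cφ / m * (1 + u₀) ^ 3 / Rc + 15 * a₁ * γ ^ 2 / (2 * m ^ 2) * (1 + u₀) ^ 4 / Real.exp (γ * u₀ / 4)
        + Rc * (1 + u₀) / (55296 * Real.pi * m * Real.exp (γ * u₀ / 4)) ≤ 1 / 4) :
    0 < θ' ∧ e₁ * (α₁ * (β₁ * φ₁ + β₂ * ξ₁) + α₂ * (τ₁ * φ₁ + τ₂ * ξ₁)) ≤ 1 / 2 := by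
  -- ### basic sizes
  have hπ : 0 < Real.pi := Real.pi_pos
  have hπ3 : 3 < Real.pi := Real.pi_gt_three
  have hm0 : 0 < m := by linarith
  have hRc0 : 0 < Rc := by linarith
  have hu₀0 : 0 < u₀ := by linarith
  have hℓ : 0 < 1 / γ := by positivity
  have hℓu : 1 / γ ≤ u₀ / 64 := by
    have e : 1 / γ = (64 / γ) / 64 := by ring
    rw [e]; linarith
  set P : ℝ := 1 + u₀ with hPdef
  set E : ℝ := Real.exp (γ * u₀ / 4) with hEdef
  have hP1 : 1 ≤ P := by rw [hPdef]; linarith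
  have hP0 : 0 < P := by linarith
  have huP : u₀ ≤ P := by rw [hPdef]; linarith
  have hE0 : 0 < E := Real.exp_pos _
  have he3 : Real.exp 1 ≤ 3 := by
    have := Real.exp_one_lt_d9; norm_num at this; linarith
  have he0 : 0 < Real.exp 1 := Real.exp_pos _
  have he14 : Real.exp (1 / 4) ≤ Real.exp 1 := Real.exp_le_exp.mpr (by norm_num)
  -- `Kb ≤ 4πP`
  have hKb_le : Kb ≤ 4 * Real.pi * P := by
    rw [hKb]
    have h6 : 2 / γ + 4 / γ ≤ u₀ := by
      have e : 2 / γ + 4 / γ = 6 * (1 / γ) := by ring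
      rw [e]; linarith
    nlinarith only [h6, hπ, huP, hu₀0]
  have hKb0 : 0 < Kb := by rw [hKb]; positivity
  -- `c₁ ≥ m/5`
  have hc₁m : m / 5 ≤ c₁ := by
    rw [hc₁]
    have hm4 : 4 ≤ m ^ 2 := by nlinarith only [hm]
    have h45 : 16 / (5 * m ^ 2) ≤ 4 / 5 := by
      rw [div_le_iff₀ (by positivity)]; linarith only [hm4]
    have := mul_le_mul_of_nonneg_right (sub_le_sub_left h45 1) hm0.le
    linarith only [this]
  have hc₁0 : 0 < c₁ := lt_of_lt_of_le (by positivity) hc₁m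
  have hinvc₁ : 1 / c₁ ≤ 5 / m := by
    rw [div_le_div_iff₀ hc₁0 hm0]; linarith only [hc₁m]
  -- `A₂b + 1 ≤ a₂ P`
  have ha₂0 : 0 < a₂ := by rw [ha₂]; positivity
  have hA₂0 : 0 ≤ A₂b := by rw [hA₂b]; positivity
  have hA₂le : A₂b + 1 ≤ a₂ * P := by
    rw [hA₂b, ha₂]
    have h1 : 4 * ((γ + 1) * Kb + 4) / c₁ = 4 * ((γ + 1) * Kb + 4) * (1 / c₁) := by ring
    rw [h1]
    have h2 : 4 * ((γ + 1) * Kb + 4) * (1 / c₁) ≤ 4 * ((γ + 1) * (4 * Real.pi * P) + 4 * P) * (5 / m) := by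
      apply mul_le_mul _ hinvc₁ (by positivity) (by positivity)
      nlinarith only [hKb_le, hP1, hγ]
    have e : 4 * ((γ + 1) * (4 * Real.pi * P) + 4 * P) * (5 / m) + P = (20 / m * (4 * Real.pi * (γ + 1) + 4) + 1) * P := by ring
    linarith only [h2, e, hP1]
  have hA₂1 : 0 < A₂b + 1 := by linarith
  -- `432 γ² u₀ ≤ cΦ ≤ cφ P`
  have hcφ0 : 0 < cφ := by rw [hcφ]; positivity
  have hcΦ_le : cΦ ≤ cφ * P := by
    rw [hcΦ, hcφ]
    have h3 : u₀ + 3 / γ ≤ 2 * P := by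
      have e : 3 / γ = 3 * (1 / γ) := by ring
      rw [e]; linarith
    have h4 : (1 + 36 * γ ^ 2) * (u₀ + 3 / γ) ≤ (1 + 36 * γ ^ 2) * (2 * P) := mul_le_mul_of_nonneg_left h3 (by positivity)
    have h5 : 81 * γ / 32 + 81 / 64 ≤ (81 * γ / 32 + 81 / 64) * P := by
      have := mul_le_mul_of_nonneg_left hP1 (show 0 ≤ 81 * γ / 32 + 81 / 64 by positivity)
      linarith only [this]
    nlinarith only [h4, h5]
  have hcΦ_ge : 432 * γ ^ 2 * u₀ ≤ cΦ := by
    rw [hcΦ]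
    have h3 : u₀ ≤ u₀ + 3 / γ := by have : 0 < 3 / γ := by positivity
                                    linarith
    nlinarith only [h3, sq_nonneg γ, hu₀0, hγ]
  have hcΦ0 : 0 < cΦ := lt_of_lt_of_le (by positivity) hcΦ_ge
  -- `u₀ − 1/γ ≥ P/4`
  have hx0 : P / 4 ≤ u₀ - 1 / γ := by rw [hPdef]; linarith
  have hx0' : 0 < u₀ - 1 / γ := lt_of_lt_of_le (by positivity) hx0
  set y : ℝ := u₀ - 1 / γ with hydef
  -- `θ′ > 0` and `1/θ′ ≤ 12 a₂ cφ P`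
  have hθ0 : 0 < θ' := by rw [hθ']; positivity
  have hθinv : 1 / θ' ≤ 12 * a₂ * cφ * P := by
    rw [hθ', one_div_div]
    rw [div_le_iff₀ hx0']
    have h1 : Real.exp 1 * (A₂b + 1) * cΦ ≤ 3 * (a₂ * P) * (cφ * P) :=
      mul_le_mul (mul_le_mul he3 hA₂le hA₂1.le (by norm_num)) hcΦ_le hcΦ0.le (by positivity)
    have h2 : 3 * (a₂ * P) * (cφ * P) ≤ 12 * a₂ * cφ * P * (u₀ - 1 / γ) := by
      have := mul_le_mul_of_nonneg_left hx0 (show 0 ≤ 12 * a₂ * cφ * P by positivity)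
      nlinarith only [this]
    exact h1.trans h2
  have ha₁0 : 0 < a₁ := by rw [ha₁]; positivity
  have hα₁le : α₁ ≤ a₁ * P := by
    rw [hα₁, ha₁]
    have : γ ≤ γ * P := by nlinarith only [hP1, hγ]
    nlinarith only [this, hθinv, hP1]
  have hα₁0 : 0 ≤ α₁ := by rw [hα₁]; positivity
  -- ### the four terms
  -- `e₁ φ₁ = e · cΦ`
  have heφ : e₁ * φ₁ = Real.exp 1 * cΦ := by
    rw [he₁, hφ₁]
    have e1 : γ * (u₀ + 3 / γ) / 4 = γ * u₀ / 4 + 3 / 4 := by field_simp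
    rw [e1, Real.exp_add, ← hEdef]
    have e2 : Real.exp 1 = Real.exp (1 / 4) * Real.exp (3 / 4) := by rw [← Real.exp_add]; norm_num
    rw [e2, div_mul_eq_mul_div, div_eq_iff hE0.ne']
    ring
  -- T1
  have hβ₁le : β₁ ≤ 80 * Real.pi * P / (m * Rc) := by
    rw [hβ₁]
    have h1 : 4 / (c₁ * Rc) = 4 * (1 / c₁) * (1 / Rc) := by field_simp
    rw [h1]
    have h2 : Kb * (4 * (1 / c₁) * (1 / Rc)) ≤ 4 * Real.pi * P * (4 * (5 / m) * (1 / Rc)) :=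
      mul_le_mul hKb_le (by
        apply mul_le_mul_of_nonneg_right _ (by positivity)
        linarith only [hinvc₁]) (by positivity) (by positivity)
    have e : 4 * Real.pi * P * (4 * (5 / m) * (1 / Rc)) = 80 * Real.pi * P / (m * Rc) := by field_simp; ring
    linarith only [h2, e]
  have hβ₁0 : 0 ≤ β₁ := by rw [hβ₁]; positivity
  have hT1 : α₁ * β₁ * (Real.exp 1 * cΦ) ≤ 240 * Real.pi * a₁ * cφ / m * P ^ 3 / Rc := by
    have h1 : α₁ * β₁ * (Real.exp 1 * cΦ) ≤ (a₁ * P) * (80 * Real.pi * P / (m * Rc)) * (3 * (cφ * P)) :=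
      mul_le_mul (mul_le_mul hα₁le hβ₁le hβ₁0 (by positivity)) (mul_le_mul he3 hcΦ_le hcΦ0.le (by norm_num))
        (by positivity) (by positivity)
    have e : (a₁ * P) * (80 * Real.pi * P / (m * Rc)) * (3 * (cφ * P)) = 240 * Real.pi * a₁ * cφ / m * P ^ 3 / Rc := by
      field_simp
      norm_num
    linarith only [h1, e]
  -- T2
  have hβ₂le : β₂ ≤ 5 * γ ^ 2 * P / m ^ 2 := by
    rw [hβ₂, hκ]
    have h1 : 4 * (γ ^ 2 * Rc / (16 * Real.pi * m)) / (c₁ * Rc) = γ ^ 2 / (4 * Real.pi * m) * (1 / c₁) := by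
      field_simp; ring
    rw [h1]
    have h2 : Kb * (γ ^ 2 / (4 * Real.pi * m) * (1 / c₁)) ≤ 4 * Real.pi * P * (γ ^ 2 / (4 * Real.pi * m) * (5 / m)) :=
      mul_le_mul hKb_le (mul_le_mul_of_nonneg_left hinvc₁ (by positivity)) (by positivity) (by positivity)
    have e : 4 * Real.pi * P * (γ ^ 2 / (4 * Real.pi * m) * (5 / m)) = 5 * γ ^ 2 * P / m ^ 2 := by field_simp
    linarith only [h2, e]
  have hβ₂0 : 0 ≤ β₂ := by rw [hβ₂, hκ]; positivity
  have he₁le : e₁ ≤ 3 / E := by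
    rw [he₁]
    exact div_le_div_of_nonneg_right (he14.trans he3) hE0.le
  have he₁0 : 0 ≤ e₁ := by rw [he₁]; positivity
  have hξ₁le : ξ₁ ≤ P ^ 2 / 2 := by
    rw [hξ₁]
    have := pow_le_pow_left₀ hu₀0.le huP 2
    linarith only [this]
  have hξ₁0 : 0 ≤ ξ₁ := by rw [hξ₁]; positivity
  have hT2 : α₁ * β₂ * ξ₁ * e₁ ≤ 15 * a₁ * γ ^ 2 / (2 * m ^ 2) * P ^ 4 / E := by
    have h1 : α₁ * β₂ * ξ₁ * e₁ ≤ (a₁ * P) * (5 * γ ^ 2 * P / m ^ 2) * (P ^ 2 / 2) * (3 / E) :=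
      mul_le_mul (mul_le_mul (mul_le_mul hα₁le hβ₂le hβ₂0 (by positivity)) hξ₁le hξ₁0 (by positivity)) he₁le he₁0
        (by positivity)
    have e : (a₁ * P) * (5 * γ ^ 2 * P / m ^ 2) * (P ^ 2 / 2) * (3 / E) = 15 * a₁ * γ ^ 2 / (2 * m ^ 2) * P ^ 4 / E := by
      field_simp
      norm_num
    linarith only [h1, e]
  -- T3 (exact)
  have hT3 : α₂ * τ₁ * (Real.exp 1 * cΦ) = 1 / 4 := by
    rw [hα₂, hτ₁, hθ']
    field_simp
  -- T4
  have hT4' : (Real.exp (1 / 4) / Real.exp 1) * (γ ^ 2 * u₀ ^ 2 / cΦ) * Rc / (128 * Real.pi * m * E)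
      ≤ Rc * P / (55296 * Real.pi * m * E) := by
    have h1 : Real.exp (1 / 4) / Real.exp 1 ≤ 1 := by rw [div_le_one he0]; exact he14
    have h2 : γ ^ 2 * u₀ ^ 2 / cΦ ≤ u₀ / 432 := by
      rw [div_le_iff₀ hcΦ0]
      have := mul_le_mul_of_nonneg_left hcΦ_ge (show 0 ≤ u₀ / 432 by positivity)
      nlinarith only [this]
    have h3 : (Real.exp (1 / 4) / Real.exp 1) * (γ ^ 2 * u₀ ^ 2 / cΦ) ≤ 1 * (P / 432) :=
      mul_le_mul h1 (h2.trans (by linarith only [huP])) (by positivity) (by norm_num)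
    have h4 := mul_le_mul_of_nonneg_right h3 (show 0 ≤ Rc by positivity)
    have h5 := div_le_div_of_nonneg_right h4 (show 0 ≤ 128 * Real.pi * m * E by positivity)
    have e2 : 1 * (P / 432) * Rc / (128 * Real.pi * m * E) = Rc * P / (55296 * Real.pi * m * E) := by
      field_simp
      ring
    linarith only [h5, e2]
  have hT4 : α₂ * τ₂ * ξ₁ * e₁ ≤ Rc * P / (55296 * Real.pi * m * E) := by
    have e : α₂ * τ₂ * ξ₁ * e₁ = (Real.exp (1 / 4) / Real.exp 1) * (γ ^ 2 * u₀ ^ 2 / cΦ) * Rc / (128 * Real.pi * m * E) := by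
      rw [hα₂, hτ₂, hξ₁, he₁, hθ', hκ]
      field_simp
      ring
    rw [e]; exact hT4'
  -- ### sum
  refine ⟨hθ0, ?_⟩
  have esplit : e₁ * (α₁ * (β₁ * φ₁ + β₂ * ξ₁) + α₂ * (τ₁ * φ₁ + τ₂ * ξ₁))
      = α₁ * β₁ * (e₁ * φ₁) + α₁ * β₂ * ξ₁ * e₁ + α₂ * τ₁ * (e₁ * φ₁) + α₂ * τ₂ * ξ₁ * e₁ := by ring
  rw [esplit, heφ]
  have hs' : 240 * Real.pi * a₁ * cφ / m * P ^ 3 / Rc + 15 * a₁ * γ ^ 2 / (2 * m ^ 2) * P ^ 4 / E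
      + Rc * P / (55296 * Real.pi * m * E) ≤ 1 / 4 := by
    simpa only [hPdef, hEdef] using hsmall
  linarith only [hT1, hT2, hT3, hT4, hs']

/-- `log x ≤ 8·√√√x` for `x > 0` (three square roots: `log x = 8 log x^{1/8} ≤ 8(x^{1/8} − 1)`). -/
theorem log_le_eight_mul_sqrt_sqrt_sqrt {x : ℝ} (hx : 0 < x) :
    Real.log x ≤ 8 * Real.sqrt (Real.sqrt (Real.sqrt x)) := by
  have h1 : Real.log x = 8 * Real.log (Real.sqrt (Real.sqrt (Real.sqrt x))) := by
    rw [Real.log_sqrt (Real.sqrt_nonneg _), Real.log_sqrt (Real.sqrt_nonneg _), Real.log_sqrt hx.le]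
    ring
  rw [h1]
  have h2 : 0 < Real.sqrt (Real.sqrt (Real.sqrt x)) := by positivity
  have h3 := Real.log_le_sub_one_of_pos h2
  linarith

/-- `(√√√x)⁴ = √x`. -/
theorem sqrt_sqrt_sqrt_pow_four (x : ℝ) :
    Real.sqrt (Real.sqrt (Real.sqrt x)) ^ 4 = Real.sqrt x := by
  have h1 : Real.sqrt (Real.sqrt (Real.sqrt x)) ^ 4 = (Real.sqrt (Real.sqrt (Real.sqrt x)) ^ 2) ^ 2 := by ring
  rw [h1, Real.sq_sqrt (Real.sqrt_nonneg _), Real.sq_sqrt (Real.sqrt_nonneg _)]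

set_option maxHeartbeats 1000000 in
/-- **The loop condition holds for large `Rc` with `u₀ = (8/γ)·log Rc` (`E = e^{γu₀/4} = Rc²`, i.e. `A = 2`).**  For `0 < γ`, `2 ≤ m` there is
`R₀ ≥ 1` (explicit: `max(e⁸, e^{γ/8}, (4C(1+64/γ)⁴)²)`, `C = 240π·a₁c_φ/m + 15a₁γ²/(2m²) + 1/(55296πm)`) such that for `Rc ≥ R₀` the inner radius
`u₀ = (8/γ)log Rc` satisfies `64/γ ≤ u₀`, `1 ≤ u₀`, `e^{γu₀/4} = Rc²`, and the smallness condition `hsmall` of `twoZone_loop_reduction`. -/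
theorem twoZone_loop_large {γ m a₂ cφ a₁ : ℝ} (hγ : 0 < γ) (hm : 2 ≤ m)
    (ha₂ : a₂ = 20 / m * (4 * Real.pi * (γ + 1) + 4) + 1)
    (hcφ : cφ = 12 * (2 * (1 + 36 * γ ^ 2) + 81 * γ / 32 + 81 / 64))
    (ha₁ : a₁ = γ + 12 * a₂ * cφ) :
    ∃ R₀ : ℝ, 1 ≤ R₀ ∧ ∀ Rc : ℝ, R₀ ≤ Rc →
      64 / γ ≤ 8 / γ * Real.log Rc ∧ 1 ≤ 8 / γ * Real.log Rc ∧ Real.exp (γ * (8 / γ * Real.log Rc) / 4) = Rc ^ 2 ∧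
      240 * Real.pi * a₁ * cφ / m * (1 + 8 / γ * Real.log Rc) ^ 3 / Rc
        + 15 * a₁ * γ ^ 2 / (2 * m ^ 2) * (1 + 8 / γ * Real.log Rc) ^ 4 / Real.exp (γ * (8 / γ * Real.log Rc) / 4)
        + Rc * (1 + 8 / γ * Real.log Rc) / (55296 * Real.pi * m * Real.exp (γ * (8 / γ * Real.log Rc) / 4)) ≤ 1 / 4 := by
  have hπ : 0 < Real.pi := Real.pi_pos
  have hm0 : 0 < m := by linarith
  have ha₂0 : 0 < a₂ := by rw [ha₂]; positivity
  have hcφ0 : 0 < cφ := by rw [hcφ]; positivity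
  have ha₁0 : 0 < a₁ := by rw [ha₁]; positivity
  -- the constant
  set C : ℝ := 240 * Real.pi * a₁ * cφ / m + 15 * a₁ * γ ^ 2 / (2 * m ^ 2) + 1 / (55296 * Real.pi * m) with hCdef
  have hC0 : 0 < C := by positivity
  set B : ℝ := 4 * C * (1 + 64 / γ) ^ 4 with hBdef
  have hB0 : 0 < B := by positivity
  refine ⟨max (max (Real.exp 8) (Real.exp (γ / 8))) (B ^ 2), ?_, ?_⟩
  · have : (1:ℝ) ≤ Real.exp 8 := Real.one_le_exp (by norm_num)
    exact le_trans this (le_trans (le_max_left _ _) (le_max_left _ _))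
  intro Rc hRc
  have hRc8 : Real.exp 8 ≤ Rc := le_trans (le_trans (le_max_left _ _) (le_max_left _ _)) hRc
  have hRcγ : Real.exp (γ / 8) ≤ Rc := le_trans (le_trans (le_max_right _ _) (le_max_left _ _)) hRc
  have hRcB : B ^ 2 ≤ Rc := le_trans (le_max_right _ _) hRc
  have hRc0 : 0 < Rc := lt_of_lt_of_le (Real.exp_pos _) hRc8
  have hRc1 : 1 ≤ Rc := le_trans (Real.one_le_exp (by norm_num)) hRc8
  -- the logarithm
  set L : ℝ := Real.log Rc with hLdef
  have hL8 : 8 ≤ L := by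
    rw [hLdef, ← Real.log_exp 8]; exact Real.log_le_log (Real.exp_pos _) hRc8
  have hLγ : γ / 8 ≤ L := by
    rw [hLdef, ← Real.log_exp (γ / 8)]; exact Real.log_le_log (Real.exp_pos _) hRcγ
  have hL0 : 0 ≤ L := by linarith
  set u₀ : ℝ := 8 / γ * L with hu₀def
  have hu₀64 : 64 / γ ≤ u₀ := by
    rw [hu₀def]
    have e : 64 / γ = 8 / γ * 8 := by ring
    rw [e]; exact mul_le_mul_of_nonneg_left hL8 (by positivity)
  have hu₀1 : 1 ≤ u₀ := by
    rw [hu₀def]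
    have e : (1:ℝ) = 8 / γ * (γ / 8) := by field_simp
    rw [e]; exact mul_le_mul_of_nonneg_left hLγ (by positivity)
  have hu₀0 : 0 ≤ u₀ := by linarith
  -- `E = Rc²`
  have hE : Real.exp (γ * u₀ / 4) = Rc ^ 2 := by
    rw [hu₀def]
    have e : γ * (8 / γ * L) / 4 = L + L := by field_simp; ring
    rw [e, Real.exp_add, hLdef, Real.exp_log hRc0]; ring
  refine ⟨hu₀64, hu₀1, hE, ?_⟩
  rw [hE]
  -- `P := 1 + u₀ ≤ (1 + 64/γ)·√√√Rc`, `P⁴ ≤ (1+64/γ)⁴ √Rc`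
  set P : ℝ := 1 + u₀ with hPdef
  have hP1 : 1 ≤ P := by rw [hPdef]; linarith
  set q : ℝ := Real.sqrt (Real.sqrt (Real.sqrt Rc)) with hqdef
  have hq1 : 1 ≤ q := by
    rw [hqdef]
    have h1 : 1 ≤ Real.sqrt Rc := by rw [← Real.sqrt_one]; exact Real.sqrt_le_sqrt hRc1
    have h2 : 1 ≤ Real.sqrt (Real.sqrt Rc) := by rw [← Real.sqrt_one]; exact Real.sqrt_le_sqrt h1
    rw [← Real.sqrt_one]; exact Real.sqrt_le_sqrt h2
  have hLq : L ≤ 8 * q := by rw [hLdef, hqdef]; exact log_le_eight_mul_sqrt_sqrt_sqrt hRc0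
  have hPq : P ≤ (1 + 64 / γ) * q := by
    rw [hPdef, hu₀def]
    have h1 : 8 / γ * L ≤ 8 / γ * (8 * q) := mul_le_mul_of_nonneg_left hLq (by positivity)
    have h2 : (1:ℝ) ≤ 1 * q := by linarith
    have e : (1 + 64 / γ) * q = 1 * q + 8 / γ * (8 * q) := by ring
    linarith [h1, h2, e]
  have hq4 : q ^ 4 = Real.sqrt Rc := by rw [hqdef]; exact sqrt_sqrt_sqrt_pow_four Rc
  have hP4 : P ^ 4 ≤ (1 + 64 / γ) ^ 4 * Real.sqrt Rc := by
    have h1 := pow_le_pow_left₀ (by linarith) hPq 4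
    rw [mul_pow, hq4] at h1; exact h1
  have hsq0 : 0 < Real.sqrt Rc := Real.sqrt_pos.mpr hRc0
  have hsqB : B ≤ Real.sqrt Rc := by
    have := Real.sqrt_le_sqrt hRcB
    rw [Real.sqrt_sq hB0.le] at this; exact this
  -- each term `≤ Cᵢ P⁴ / Rc`
  have hRc2 : Rc ≤ Rc ^ 2 := by nlinarith
  have hP34 : P ^ 3 ≤ P ^ 4 := by
    have := pow_le_pow_right₀ hP1 (show 3 ≤ 4 by norm_num); exact this
  have hP14 : P ≤ P ^ 4 := by
    have := pow_le_pow_right₀ hP1 (show 1 ≤ 4 by norm_num); rw [pow_one] at this; exact this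
  have hP0 : 0 < P := by linarith
  have ht1 : 240 * Real.pi * a₁ * cφ / m * P ^ 3 / Rc ≤ 240 * Real.pi * a₁ * cφ / m * (P ^ 4 / Rc) := by
    rw [mul_div_assoc]
    exact mul_le_mul_of_nonneg_left (div_le_div_of_nonneg_right hP34 hRc0.le) (by positivity)
  have ht2 : 15 * a₁ * γ ^ 2 / (2 * m ^ 2) * P ^ 4 / Rc ^ 2 ≤ 15 * a₁ * γ ^ 2 / (2 * m ^ 2) * (P ^ 4 / Rc) := by
    rw [mul_div_assoc]
    exact mul_le_mul_of_nonneg_left (div_le_div_of_nonneg_left (by positivity) hRc0 hRc2) (by positivity)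
  have ht4 : Rc * P / (55296 * Real.pi * m * Rc ^ 2) ≤ 1 / (55296 * Real.pi * m) * (P ^ 4 / Rc) := by
    have e : Rc * P / (55296 * Real.pi * m * Rc ^ 2) = 1 / (55296 * Real.pi * m) * (P / Rc) := by
      field_simp
    rw [e]
    exact mul_le_mul_of_nonneg_left (div_le_div_of_nonneg_right hP14 hRc0.le) (by positivity)
  have hsum : 240 * Real.pi * a₁ * cφ / m * P ^ 3 / Rc + 15 * a₁ * γ ^ 2 / (2 * m ^ 2) * P ^ 4 / Rc ^ 2
      + Rc * P / (55296 * Real.pi * m * Rc ^ 2) ≤ C * (P ^ 4 / Rc) := by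
    have e : C * (P ^ 4 / Rc) = 240 * Real.pi * a₁ * cφ / m * (P ^ 4 / Rc) + 15 * a₁ * γ ^ 2 / (2 * m ^ 2) * (P ^ 4 / Rc)
        + 1 / (55296 * Real.pi * m) * (P ^ 4 / Rc) := by rw [hCdef]; ring
    rw [e]; linarith [ht1, ht2, ht4]
  -- `C P⁴/Rc ≤ C (1+64/γ)⁴ √Rc / Rc = C(1+64/γ)⁴/√Rc ≤ 1/4`
  have hfin : C * (P ^ 4 / Rc) ≤ 1 / 4 := by
    have h1 : C * (P ^ 4 / Rc) ≤ C * ((1 + 64 / γ) ^ 4 * Real.sqrt Rc / Rc) :=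
      mul_le_mul_of_nonneg_left (div_le_div_of_nonneg_right hP4 hRc0.le) hC0.le
    have e : C * ((1 + 64 / γ) ^ 4 * Real.sqrt Rc / Rc) = (B / 4) / Real.sqrt Rc := by
      rw [hBdef, eq_div_iff hsq0.ne']
      have hRe : Real.sqrt Rc * Real.sqrt Rc = Rc := Real.mul_self_sqrt hRc0.le
      have e3 : C * ((1 + 64 / γ) ^ 4 * Real.sqrt Rc / Rc) * Real.sqrt Rc
          = C * (1 + 64 / γ) ^ 4 * ((Real.sqrt Rc * Real.sqrt Rc) / Rc) := by ring
      rw [e3, hRe, div_self hRc0.ne']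
      ring
    rw [e] at h1
    have h2 : (B / 4) / Real.sqrt Rc ≤ 1 / 4 := by
      rw [div_le_iff₀ hsq0]; linarith [hsqB]
    exact h1.trans h2
  exact hsum.trans hfin

end Summit.NavierStokesRegularity.NavierStokesRegularity.Theorems.DefectColumnGate

end
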